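import Summits.CriticalPhenomena.CardyFormulaZ2.Theorems.CardySusyWardParafermionFamiliesToSLESixCornerFormStructureA
import Literature.Probability.LatticeModels.MedialWindingBridge

/-!
# The corner (dart) form of the `q = 1` parafermionic observable at the boundary arcs, II:
# evaluation of boundary darts — the free-arc touch law and the wired-arc law

Helper file for the crux `CardySusyWard.ParafermionFamiliesToSLESix` (stmt-CriticalPhenomena-10814),
line `exact-potential-schwarz-christoffel`, stub `stub_cornerFormStructure`, clauses (c) and (d)
(Duminil-Copin 2012, Prop. 5 for the tree's corner observable `cornerObs` of `CardyComplexConeDefs.lean`,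
read at an arbitrary mesh `δ ≠ 0`).  Admissible data `E` with hole-free inner faces.

* `cornerPhase_eq_dartW`, `cornerObs_eq_of_dartW`, `cornerObs_eq_of_turnCount` — the integrand
  `cornerPhase` of `CardyComplexConeDefs.lean` is pathwise the dart weight `S2.dartW` of the coded corner,
  and a corner visited with constant turn count `τ` has `cornerObs = sixthPhase τ · P(visit)`.
* `freeArc_touch_law` (clause (c)): for an inner face `f` with a corner on the arc `B` and a corner `x`,
  `cornerObs E δ x f = (phase of the ALL-OPEN exploration) · P[x ↔ A]`, `P[dart (x,f)] = P[x ↔ A]`, the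
  phase has modulus `≤ 1` and `= 1` when the touch has positive probability (part I: TouchModulus
  `visit_iff_reachable`, TouchPhase `turnCount_touch`, monotonicity `touch_mono`).
* `wiredArc_law` (clause (d)): for a corner `(y, f)` with `y` on the arc `A`,
  `cornerObs E δ y f = (phase of the ALL-CLOSED exploration) · P[dart (y,f)]` etc. (the tree's
  `WiredTouch.visit_anti`, `WiredTouch.turnCount_visit_const`).
-/

noncomputable section

namespace Summit.CriticalPhenomena.CardyFormulaZ2.Theorems.ParafermionFamiliesToSLESix.StripAnchored

open MeasureTheory Function
open Literature.Probability.Percolation (bondPercolation half BondConfig openGraph)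
open Literature.Probability.LatticeModels
open Literature.Probability.LatticeModels.DiscreteDobrushin (startCorner exitTime isStartCorner_startCorner
  isInnerFace_of_lt_exitTime not_isInnerFace_exitTime medialExploration_eq_explorationList)
open Summit.CriticalPhenomena.CardyFormulaZ2.Cruxes.EdgePrecompact.QkzStripBoundaryArm (cornerObs)
open Summit.CriticalPhenomena.CardyFormulaZ2.Cruxes.CoherentMorera.FinitaryGreenPairing (cornerPhase)
open S2 (sixthPhase dartW dartW_eq_single dartW_eq_zero cornerIntegrand cornerIntegrand_explorationList
  cornerObs_eq_integral)

namespace CornerForm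

variable {E : DiscreteDobrushin} {ω : BondConfig (Site 2)}

/-! ## Evaluation of corner observables at an arbitrary reading mesh -/

/-- The integrand `cornerPhase` of `CardyComplexConeDefs.lean` is, pathwise, the dart weight `dartW` of
the coded corner. [folklore] -/
theorem cornerPhase_eq_dartW (hE : E.IsZdAdmissible) {δ : ℝ} (hδ : δ ≠ 0) {r : Site 2 × Fin 4} {v f : Site 2}
    (h1 : r.1 = v) (h2 : cFace r = f) (ω : BondConfig (Site 2)) :
    cornerPhase δ E v f ω = dartW (E.bcBondConfig ω) (startCorner hE) r (exitTime hE ω) := by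
  -- buildfix 2026-08-20 (proof-only, regime-robust): `cornerPhase` spells the fully-qualified
  -- `…LatticeModels.winding` (= `FermionicObservable`'s copy when in the closure), `cornerIntegrand` the
  -- `Polyline` copy; bridge them (`MedialWindingBridge`) instead of `show`.
  rw [show cornerPhase δ E v f ω = cornerIntegrand δ v f (medialExploration E ω) from by
    first
      | rfl
      | (unfold cornerPhase cornerIntegrand;
         simp only [Literature.Probability.LatticeModels.Polyline.winding_eq_winding'])]
  rw [medialExploration_eq_explorationList hE ω, cornerIntegrand_explorationList hδ _ _ _ h1 h2]

/-- **Integration step at reading mesh `δ`**: if pathwise the dart weight of the coded corner `r` (vertex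
`v`, face `f`) is the indicator of the visit event of `r` times the constant `c`, then
`cornerObs E δ v f = c · P(r is visited)`. [folklore] -/
theorem cornerObs_eq_of_dartW (hE : E.IsZdAdmissible) {δ : ℝ} (hδ : δ ≠ 0) {r : Site 2 × Fin 4} {v f : Site 2}
    (h1 : r.1 = v) (h2 : cFace r = f) (c : ℂ)
    (hW : ∀ ω : BondConfig (Site 2), dartW (E.bcBondConfig ω) (startCorner hE) r (exitTime hE ω) =
      Set.indicator {ω : BondConfig (Site 2) | ∃ n < exitTime hE ω,
        cornerOrbit (E.bcBondConfig ω) (startCorner hE) n = r} (fun _ => c) ω) :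
    cornerObs E δ v f = c * (((bondPercolation (zdGraph 2) half).real
      {ω : BondConfig (Site 2) | ∃ n < exitTime hE ω, cornerOrbit (E.bcBondConfig ω) (startCorner hE) n = r} : ℝ) : ℂ) := by
  -- adapted from `S5.cornerObs_eq_of_dartW` (`…AnchoredWallFluxDarts.lean`)
  rw [cornerObs_eq_integral]
  have key : ∀ ω : BondConfig (Site 2), cornerIntegrand δ v f (medialExploration E ω) =
      Set.indicator {ω : BondConfig (Site 2) | ∃ n < exitTime hE ω,
        cornerOrbit (E.bcBondConfig ω) (startCorner hE) n = r} (fun _ => c) ω := fun ω => by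
    rw [medialExploration_eq_explorationList hE ω, cornerIntegrand_explorationList hδ _ _ _ h1 h2, hW]
  simp_rw [key]
  rw [integral_indicator_const c (WiredTouch.measurableSet_visit hE r), Complex.real_smul, mul_comm]

/-- **Evaluation on a visit with constant turn count**: if the turn count at every visit of `r` is `τ`,
then `cornerObs E δ v f = sixthPhase τ · P(r is visited)`. [cite: DuminilCopin2012Parafermion, Proposition 5] -/
theorem cornerObs_eq_of_turnCount (hE : E.IsZdAdmissible) {δ : ℝ} (hδ : δ ≠ 0) {r : Site 2 × Fin 4}
    {v f : Site 2} (h1 : r.1 = v) (h2 : cFace r = f) (τ : ℤ)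
    (hτ : ∀ (ω : BondConfig (Site 2)) (j : ℕ), j < exitTime hE ω →
      cornerOrbit (E.bcBondConfig ω) (startCorner hE) j = r → turnCount (E.bcBondConfig ω) (startCorner hE) j = τ) :
    cornerObs E δ v f = sixthPhase τ * (((bondPercolation (zdGraph 2) half).real
      {ω : BondConfig (Site 2) | ∃ n < exitTime hE ω, cornerOrbit (E.bcBondConfig ω) (startCorner hE) n = r} : ℝ) : ℂ) := by
  refine cornerObs_eq_of_dartW hE hδ h1 h2 _ fun ω => ?_
  by_cases ht : ω ∈ {ω : BondConfig (Site 2) | ∃ n < exitTime hE ω,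
      cornerOrbit (E.bcBondConfig ω) (startCorner hE) n = r}
  · rw [Set.indicator_of_mem ht]
    obtain ⟨j, hj, hjr⟩ := ht
    rw [dartW_eq_single hj fun _ hj' => ⟨fun h => S5.orbit_inj hE (fun _ hk => isInnerFace_of_lt_exitTime hE ω hk)
      hj' hj (h.trans hjr.symm), fun h => h ▸ hjr⟩, hτ ω j hj hjr]
  · rw [Set.indicator_of_notMem ht]
    exact dartW_eq_zero fun j hj hjr => ht ⟨j, hj, hjr⟩

/-- The dart weight at a visit with turn count `τ` is `sixthPhase τ`. [folklore] -/
theorem dartW_eq_of_visit (hE : E.IsZdAdmissible) {r : Site 2 × Fin 4} {m : ℕ} (hm : m < exitTime hE ω)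
    (hmr : cornerOrbit (E.bcBondConfig ω) (startCorner hE) m = r) :
    dartW (E.bcBondConfig ω) (startCorner hE) r (exitTime hE ω) = sixthPhase (turnCount (E.bcBondConfig ω) (startCorner hE) m) :=
  dartW_eq_single hm fun _ hj' => ⟨fun h => S5.orbit_inj hE (fun _ hk => isInnerFace_of_lt_exitTime hE ω hk)
    hj' hm (h.trans hmr.symm), fun h => h ▸ hmr⟩

/-- `‖sixthPhase τ‖ = 1`. [folklore] -/
theorem norm_sixthPhase (τ : ℤ) : ‖sixthPhase τ‖ = 1 := by
  rw [sixthPhase, Complex.norm_exp_ofReal_mul_I]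

/-! ## Clause (c): the free-arc touch law -/

/-- **Clause (c), the free-arc touch law** (Duminil-Copin 2012, Prop. 5, for the tree's `q = 1` corner
observable). For admissible data with hole-free inner faces, an inner face `f` with a corner `y` on the
dual-wired arc `B` and any corner `x` of `f`: the dart `(x, f)` is traversed iff `x` is joined to the
wired arc, with the configuration-independent phase of the ALL-OPEN exploration, so that at every
reading mesh `δ ≠ 0`: `cornerObs = (all-open phase) · P[x ↔ A]`, `P[dart] = P[x ↔ A]`, the phase has
modulus `≤ 1`, and `= 1` when the touch has positive probability. [cite: DuminilCopin2012Parafermion, Proposition 5] -/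
theorem freeArc_touch_law (hE : E.IsZdAdmissible) (hH : HoleFree {f : Site 2 | E.IsInnerFace f}) {δ : ℝ}
    (hδ : δ ≠ 0) {x y f : Site 2} (hf : E.IsInnerFace f) (hx : IsCorner x f) (hy : IsCorner y f)
    (hyB : y ∈ E.zdArcB) :
    cornerObs E δ x f = cornerPhase δ E x f (Set.univ : BondConfig (Site 2)) *
        ((bondPercolation (zdGraph 2) half).real
          {ω | ∃ a ∈ E.zdArcA, (openGraph (E.bcBondConfig ω)).Reachable x a} : ℂ) ∧
      (bondPercolation (zdGraph 2) half).real
          {ω | ∃ k : ℕ, (medialExploration E ω)[k]? = some (cornerSource x f) ∧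
            (medialExploration E ω)[k + 1]? = some (cornerTarget x f)} =
        (bondPercolation (zdGraph 2) half).real
          {ω | ∃ a ∈ E.zdArcA, (openGraph (E.bcBondConfig ω)).Reachable x a} ∧
      ‖cornerPhase δ E x f (Set.univ : BondConfig (Site 2))‖ ≤ 1 ∧
      (0 < (bondPercolation (zdGraph 2) half).real
          {ω | ∃ a ∈ E.zdArcA, (openGraph (E.bcBondConfig ω)).Reachable x a} →
        ‖cornerPhase δ E x f (Set.univ : BondConfig (Site 2))‖ = 1) := by
  obtain ⟨j, hj⟩ := exists_faceAt_of_isCorner hx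
  set r : Site 2 × Fin 4 := (x, j) with hr
  have h1 : r.1 = x := rfl
  have h2 : cFace r = f := hj.symm
  have hf' : E.IsInnerFace (cFace r) := h2 ▸ hf
  have hy' : IsCorner y (cFace r) := h2 ▸ hy
  set V : Set (BondConfig (Site 2)) := {ω | ∃ n < exitTime hE ω,
    cornerOrbit (E.bcBondConfig ω) (startCorner hE) n = r} with hV
  have hdart : {ω : BondConfig (Site 2) | ∃ k : ℕ, (medialExploration E ω)[k]? = some (cornerSource x f) ∧
      (medialExploration E ω)[k + 1]? = some (cornerTarget x f)} = V :=
    Set.ext fun ω => dart_iff_visit hE h1 h2 ω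
  have hconn : {ω : BondConfig (Site 2) | ∃ a ∈ E.zdArcA, (openGraph (E.bcBondConfig ω)).Reachable x a} = V :=
    Set.ext fun ω => (visit_iff_reachable (ω := ω) hE hH hf' hy' hyB).symm
  rw [hdart, hconn]
  by_cases huniv : ∃ m < exitTime hE Set.univ, cornerOrbit (E.bcBondConfig Set.univ) (startCorner hE) m = r
  · obtain ⟨m, hm, hmr⟩ := huniv
    set τ := turnCount (E.bcBondConfig Set.univ) (startCorner hE) m with hτdef
    have hτ : ∀ (ω : BondConfig (Site 2)) (k : ℕ), k < exitTime hE ω →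
        cornerOrbit (E.bcBondConfig ω) (startCorner hE) k = r → turnCount (E.bcBondConfig ω) (startCorner hE) k = τ :=
      fun ω k hk hkr => turnCount_touch hE hH hf' hy' hyB hk hm hkr hmr
    have hphase : cornerPhase δ E x f (Set.univ : BondConfig (Site 2)) = sixthPhase τ := by
      rw [cornerPhase_eq_dartW hE hδ h1 h2, dartW_eq_of_visit hE hm hmr]
    rw [hphase, norm_sixthPhase]
    exact ⟨cornerObs_eq_of_turnCount hE hδ h1 h2 τ hτ, rfl, le_rfl, fun _ => rfl⟩
  · have hnone : ∀ ω : BondConfig (Site 2), ω ∉ V := fun ω ⟨n, hn, hnr⟩ =>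
      huniv (touch_mono hE hH hf' hy' hyB (Set.subset_univ ω) hnr)
    have hV0 : V = ∅ := Set.eq_empty_of_forall_notMem hnone
    have hphase : cornerPhase δ E x f (Set.univ : BondConfig (Site 2)) = 0 := by
      rw [cornerPhase_eq_dartW hE hδ h1 h2]
      exact dartW_eq_zero fun j hj hjr => huniv ⟨j, hj, hjr⟩
    have hobs : cornerObs E δ x f = 0 := by
      rw [cornerObs_eq_of_dartW hE hδ h1 h2 0 fun ω => ?_, zero_mul]
      rw [Set.indicator_of_notMem (hnone ω)]
      exact dartW_eq_zero fun j hj hjr => hnone ω ⟨j, hj, hjr⟩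
    rw [hphase, hobs, hV0, measureReal_empty]
    simp

/-! ## Clause (d): the wired-arc law -/

/-- **Clause (d), the wired-arc law** (dual of (c): Duminil-Copin 2012, Prop. 5 on the wired arc). For
admissible data with hole-free inner faces and a corner `(y, f)` with `y` on the wired arc `A`: a visit
of the dart `(y, f)` persists when edges are closed and its winding is configuration-independent
(`WiredTouch.visit_anti`, `WiredTouch.turnCount_visit_const`), so that at every reading mesh `δ ≠ 0`:
`cornerObs = (all-closed phase) · P[dart]`, the phase has modulus `≤ 1`, and `= 1` when the dart has
positive probability. [cite: DuminilCopin2012Parafermion, Proposition 5] -/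
theorem wiredArc_law (hE : E.IsZdAdmissible) (hH : HoleFree {f : Site 2 | E.IsInnerFace f}) {δ : ℝ}
    (hδ : δ ≠ 0) {y f : Site 2} (hyf : IsCorner y f) (hyA : y ∈ E.zdArcA) :
    cornerObs E δ y f = cornerPhase δ E y f (∅ : BondConfig (Site 2)) *
        ((bondPercolation (zdGraph 2) half).real
          {ω | ∃ k : ℕ, (medialExploration E ω)[k]? = some (cornerSource y f) ∧
            (medialExploration E ω)[k + 1]? = some (cornerTarget y f)} : ℂ) ∧
      ‖cornerPhase δ E y f (∅ : BondConfig (Site 2))‖ ≤ 1 ∧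
      (0 < (bondPercolation (zdGraph 2) half).real
          {ω | ∃ k : ℕ, (medialExploration E ω)[k]? = some (cornerSource y f) ∧
            (medialExploration E ω)[k + 1]? = some (cornerTarget y f)} →
        ‖cornerPhase δ E y f (∅ : BondConfig (Site 2))‖ = 1) := by
  obtain ⟨j, hj⟩ := exists_faceAt_of_isCorner hyf
  set r : Site 2 × Fin 4 := (y, j) with hr
  have h1 : r.1 = y := rfl
  have h2 : cFace r = f := hj.symm
  have hA : r.1 ∈ E.zdArcA := hyA
  set V : Set (BondConfig (Site 2)) := {ω | ∃ n < exitTime hE ω,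
    cornerOrbit (E.bcBondConfig ω) (startCorner hE) n = r} with hV
  have hdart : {ω : BondConfig (Site 2) | ∃ k : ℕ, (medialExploration E ω)[k]? = some (cornerSource y f) ∧
      (medialExploration E ω)[k + 1]? = some (cornerTarget y f)} = V :=
    Set.ext fun ω => dart_iff_visit hE h1 h2 ω
  rw [hdart]
  by_cases hemp : ∃ m < exitTime hE ∅, cornerOrbit (E.bcBondConfig ∅) (startCorner hE) m = r
  · obtain ⟨m, hm, hmr⟩ := hemp
    set τ := turnCount (E.bcBondConfig ∅) (startCorner hE) m with hτdef
    have hτ : ∀ (ω : BondConfig (Site 2)) (k : ℕ), k < exitTime hE ω →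
        cornerOrbit (E.bcBondConfig ω) (startCorner hE) k = r → turnCount (E.bcBondConfig ω) (startCorner hE) k = τ :=
      fun ω k hk hkr => WiredTouch.turnCount_visit_const hE hH hA hm hmr rfl ω k hk hkr
    have hphase : cornerPhase δ E y f (∅ : BondConfig (Site 2)) = sixthPhase τ := by
      rw [cornerPhase_eq_dartW hE hδ h1 h2, dartW_eq_of_visit hE hm hmr]
    rw [hphase, norm_sixthPhase]
    exact ⟨cornerObs_eq_of_turnCount hE hδ h1 h2 τ hτ, le_rfl, fun _ => rfl⟩
  · have hnone : ∀ ω : BondConfig (Site 2), ω ∉ V := fun ω ⟨n, hn, hnr⟩ =>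
      hemp (WiredTouch.visit_anti hE hH hA (Set.empty_subset ω) hn hnr)
    have hV0 : V = ∅ := Set.eq_empty_of_forall_notMem hnone
    have hphase : cornerPhase δ E y f (∅ : BondConfig (Site 2)) = 0 := by
      rw [cornerPhase_eq_dartW hE hδ h1 h2]
      exact dartW_eq_zero fun j hj hjr => hemp ⟨j, hj, hjr⟩
    have hobs : cornerObs E δ y f = 0 := by
      rw [cornerObs_eq_of_dartW hE hδ h1 h2 0 fun ω => ?_, zero_mul]
      rw [Set.indicator_of_notMem (hnone ω)]
      exact dartW_eq_zero fun j hj hjr => hnone ω ⟨j, hj, hjr⟩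
    rw [hphase, hobs, hV0, measureReal_empty]
    simp

end CornerForm

/-- **Registered one-line form `stub_cornerForm_wired`** of `CornerForm.wiredArc_law` (clause (d) of stub
`stub_cornerFormStructure`, line `exact-potential-schwarz-christoffel`). [cite: DuminilCopin2012Parafermion, Proposition 5] -/
theorem stub_cornerForm_wired : ∀ (E : DiscreteDobrushin) (δ : ℝ) (y f : Site 2), E.IsZdAdmissible → HoleFree {f : Site 2 | E.IsInnerFace f} → δ ≠ 0 → IsCorner y f → y ∈ E.zdArcA → cornerObs E δ y f = cornerPhase δ E y f (∅ : BondConfig (Site 2)) * ((bondPercolation (zdGraph 2) half).real {ω | ∃ k : ℕ, (medialExploration E ω)[k]? = some (cornerSource y f) ∧ (medialExploration E ω)[k + 1]? = some (cornerTarget y f)} : ℂ) ∧ ‖cornerPhase δ E y f (∅ : BondConfig (Site 2))‖ ≤ 1 ∧ (0 < (bondPercolation (zdGraph 2) half).real {ω | ∃ k : ℕ, (medialExploration E ω)[k]? = some (cornerSource y f) ∧ (medialExploration E ω)[k + 1]? = some (cornerTarget y f)} → ‖cornerPhase δ E y f (∅ : BondConfig (Site 2))‖ = 1) :=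
  fun _ _ _ _ hE hH hδ hyf hyA => CornerForm.wiredArc_law hE hH hδ hyf hyA

end Summit.CriticalPhenomena.CardyFormulaZ2.Theorems.ParafermionFamiliesToSLESix.StripAnchored

end
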